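import Summits.BirchSwinnertonDyer.BirchSwinnertonDyer.Theorems.AlignedTransportAtTwoMainConjectureOfRankZeroBSDAtTwoHalfDescentLayerIndexGrowthFiniteTwo
import Literature.NumberTheory.EllipticCurves.IwasawaTowerTorsionProofs
import Literature.NumberTheory.EllipticCurves.IwasawaSelmerControlKernelCardProofs
import Literature.NumberTheory.EllipticCurves.SelmerDescentCurrencyProofs
import HarnessLib

/-!
# Route `AlignedTransportAtTwo`, crux C2 `MainConjectureOfRankZeroBSDAtTwo` (stmt-BirchSwinnertonDyer-22298):
# THE GROWTH NUMBER AT FINITE LEVEL, VI — WITHOUT `p`-TORSION OVER THE BASE (`E(K)[p] = 0`, e.g. the seed cell at `p = 2`): `ker h_n = 0`, `#coker s_n = #ker g_n`,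
# and the SHARP SANDWICH `#I_{n+1} ∣ g_n ∣ #I_{n+1} · #ker g_{n+1}` — the growth number of `X(E/K_∞)` read on ONE honest finite-level Selmer group; `p = 2`:
# `g_n ∣ #ker(N_{ℚ_{n+1}/ℚ_n} | Sel_{2^∞}(W/ℚ_{n+1})) · #ker g_{n+1}` and `2^{2ⁿμ} ∣` the same at EVERY layer

HONEST FRAMING (cell `bsd-f1-sign2`, WIDTH-5 attached prover seat `bsd-line-att-p5` gen 57 on line `birth` of the lead `bsd-line-att-p2`;
`--supports` stmt-BirchSwinnertonDyer-22298, closes nothing; BSD is NOT proved by any of this; the crux C2, its verdict «blocked-on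
`Rank1Residual.GreenbergMuConjectureIrreducible`» and every registered stub (P / T / Kμ / LimDoor / MuIneqʳ / PFμ⁺) are untouched). THEOREMS ONLY — no `def`,
no instance, no named fact, no `sorry`. Route-independent. Sequel of `…GrowthFinite` / `…GrowthFiniteTwo` (hypothesis-free: `g_n·#(ker h_{n+1} ⊓ I_{n+1}) ∣ #I_{n+1}·#coker s_{n+1}`,
`#I_{n+1} ∣ g_n·#ker s_{n+1}`; `p = 2`: `#I ∣ #M ∣ #I·#M[2]`). When `E(K)` has no point of order `p` the restriction kernels `ker h_n ≅ E[p^∞]^{Gal(K̄/K_n)}` vanish at EVERY layer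
(pro-`p` fixed-point principle, tree `natCard_fixedBy_layerSubgroup_eq_one`), and the factors `#(ker h ⊓ ·)`, `#ker s` drop out:

* §1 (any number field `K`, any `p`, any `ℤ_p`-extension, any datum; hypothesis `E(K)[p] = 0` as `∀ P, p•P = 0 → P = 0`): `natCard_ker_layerToInfty_eq_one`,
  `natCard_ker_layerToInfty_inf_eq_one`, ★ `natCard_cokerS_eq_natCard_kerG` (**`#coker s_n = #ker g_n`**), ★★★ `natCard_map_selmerLayer_dvd_growth_dvd`
  (**`#I_{n+1} ∣ g_n ∣ #I_{n+1}·#ker g_{n+1}`**), ★★ `pow_dvd_natCard_map_selmerLayer_mul_kerG` (`X` f.g. torsion: **`p^{pⁿ(p−1)μ} ∣ #I_{n+1}·#ker g_{n+1}`** at EVERY layer).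
* §2 (`K = ℚ`, `p = 2`, the crux binder `∀ x, ¬HasRationalTwoTorsionX W x` ⟹ `E(ℚ)[2] = 0` by gen 44's lemma, any `DecidableEq` instance): ★★★ `growth_dvd_normKer_mul_kerG_and_normKer_dvd`
  (**`#I_{n+1} ∣ g_n ∣ #I_{n+1}·#ker g_{n+1}`, `g_n ∣ #M_{n+1}·#ker g_{n+1}`, `#M_{n+1} ∣ g_n·#M_{n+1}[2]`**, `M_{n+1}` the kernel of the relative norm on `Sel_{2^∞}(W/ℚ_{n+1})`),
  ★★ `pow_dvd_natCard_normKer_mul_kerG` (**`2^{2ⁿμ} ∣ #M_{n+1}·#ker g_{n+1}`** at EVERY layer).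
Reading: on the seed cell, under MC for an anchor with `λ_an = 2` and no finite submodule, `g_n = 4` for `n ≥ 1`, so `#I_{n+1} ∈ {1, 2, 4}` and `4 ∣ #I_{n+1}·#ker g_{n+1}` at
every `n ≥ 1`; `μ ≥ 1` would instead force `2^{2ⁿ} ∣ #I_{n+1}·#ker g_{n+1}` for all `n`. What is NOT claimed: nothing about any curve; no Selmer group computed; C2 untouched.
Memo `Cruxes/MainConjectureOfRankZeroBSDAtTwo/GROWTH-FINITE-att-p5-g57.md`.

References: R. Greenberg, LNM 1716 (1999), §1 pp. 60–65, §3 Lemma 3.1 and pp. 85–90, §4 Lemma 4.3, Thm. 1.10, Conj. 1.11 [GreenbergLNM1716]; B. Mazur, Invent. Math. 18 (1972) §6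
[Mazur1972]; J. Silverman, AEC, III.§2, X.4.2 [SilvermanAEC2009]; L. Washington, GTM 83 §13.3 [Washington1997].
-/

set_option linter.dupNamespace false
set_option autoImplicit false

noncomputable section

open scoped Classical AddSubgroup Polynomial

universe u

namespace Summit.BirchSwinnertonDyer.BirchSwinnertonDyer.Theorems.AlignedTransportAtTwoHalfDescentLayerIndexGrowthFiniteCell

open WeierstrassCurve Literature.NumberTheory.EllipticCurves Literature.NumberTheory.EllipticCurves.IwasawaDual
  Literature.NumberTheory.EllipticCurves.IwasawaAlgebra
  Literature.NumberTheory.EllipticCurves.Greenberg1999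
  Summit.BirchSwinnertonDyer.Rank1Residual.X1.MuLambda
  Summit.BirchSwinnertonDyer.Rank1Residual.Iwasawa
  Summit.BirchSwinnertonDyer.BirchSwinnertonDyer.Theorems.AlignedTransportAtTwoHalfDescentLayerIndexGrowth
  Summit.BirchSwinnertonDyer.BirchSwinnertonDyer.Theorems.AlignedTransportAtTwoHalfDescentLayerIndexGrowthDual
  Summit.BirchSwinnertonDyer.BirchSwinnertonDyer.Theorems.AlignedTransportAtTwoHalfDescentLayerIndexGrowthFinite
  Summit.BirchSwinnertonDyer.BirchSwinnertonDyer.Theorems.AlignedTransportAtTwoHalfDescentLayerIndexGrowthFiniteTwo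

/-! ## §1 `E(K)[p] = 0`: the restriction kernels vanish, `#coker s_n = #ker g_n`, and `#I_{n+1} ∣ g_n ∣ #I_{n+1} · #ker g_{n+1}` -/

section NoTorsion

variable {K : Type u} [Field K] [NumberField K] (W : WeierstrassCurve K) [W.IsElliptic] {p : ℕ} [hp : Fact p.Prime] (κ : ZpExtension K p)
  {γ : Field.absoluteGaloisGroup K}

/-- **`E(K)[p] = 0 ⟹ #ker h_n = 1` at every layer** (`ker h_n ≅ E[p^∞]^{Gal(K̄/K_n)}`, tree; pro-`p` fixed-point principle, tree `natCard_fixedBy_layerSubgroup_eq_one`).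
[cite: GreenbergLNM1716, §3 Lemma 3.1 and §4 Lemma 4.3] -/
theorem natCard_ker_layerToInfty_eq_one (hK : ∀ P : W.toAffine.Point, p • P = 0 → P = 0) (n : ℕ) : Nat.card (W.layerToInfty κ n).ker = 1 := by
  haveI := W.finite_fixedPoints_kerSubgroup_geomPrimaryTorsion κ hK
  rw [W.natCard_ker_layerToInfty_eq_natCard_fixedPoints κ n, W.natCard_fixedBy_layerSubgroup_eq_one κ hK n]

/-- `E(K)[p] = 0 ⟹` every subgroup of `H¹(K_n, E[p^∞])` meets `ker h_n` trivially: `#(ker h_n ⊓ S) = 1`. [cite: GreenbergLNM1716, §3 Lemma 3.1] -/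
theorem natCard_ker_layerToInfty_inf_eq_one (hK : ∀ P : W.toAffine.Point, p • P = 0 → P = 0) (n : ℕ)
    (S : AddSubgroup (W.subgroupH1 p (κ.layerSubgroup n))) : Nat.card ↥((W.layerToInfty κ n).ker ⊓ S) = 1 := by
  have h1 := natCard_ker_layerToInfty_eq_one W κ hK n
  have hpos : 0 < Nat.card (W.layerToInfty κ n).ker := by rw [h1]; exact Nat.one_pos
  haveI : Finite (W.layerToInfty κ n).ker := (Nat.card_pos_iff.mp hpos).2
  haveI : Finite ↥((W.layerToInfty κ n).ker ⊓ S) := Finite.of_injective _ (AddSubgroup.inclusion_injective (inf_le_left : (W.layerToInfty κ n).ker ⊓ S ≤ _))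
  have hle := Nat.le_of_dvd hpos (AddSubgroup.card_dvd_of_le (inf_le_left : (W.layerToInfty κ n).ker ⊓ S ≤ _))
  rw [h1] at hle
  exact le_antisymm hle Nat.card_pos

/-- **`E(K)[p] = 0 ⟹ #coker s_n = #ker g_n`** (Greenberg's snake count `#ker s_n·#ker g_n = #ker h_n·#coker s_n` with `ker h_n = 0`). [cite: GreenbergLNM1716, §3 p. 86, §4 Lemma 4.3] -/
theorem natCard_cokerS_eq_natCard_kerG (hK : ∀ P : W.toAffine.Point, p • P = 0 → P = 0) (n : ℕ) : Nat.card (W.CokerS κ n) = Nat.card (W.KerG κ n) := by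
  have h := W.natCard_kerS_mul_natCard_kerG κ n
  rw [natCard_ker_layerToInfty_inf_eq_one W κ hK n, natCard_ker_layerToInfty_eq_one W κ hK n, one_mul, one_mul] at h
  exact h.symm

/-- ★★★ **`E(K)[p] = 0`: `#I_{n+1} ∣ g_n ∣ #I_{n+1} · #ker g_{n+1}`** for EVERY `ℤ_p`-extension of `K` with topological generator `γ`, every Pontryagin-dual datum and every `n`
(`I_{n+1} = (conj_{γ^{pⁿ}} − 1)·Sel_{p^∞}(E/K_{n+1})`, `g_n = #(ω_nX/ω_{n+1}X)`, `ker g_{n+1} = A_{n+1}/Sel_{n+1}`): the growth number of the Iwasawa module is squeezed between the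
finite-level image and the image times Greenberg's control kernel. No other hypothesis. [cite: GreenbergLNM1716, §1 pp. 60–65, §3 pp. 85–90, §4 Lemma 4.3] [cite: Mazur1972, §6] -/
theorem natCard_map_selmerLayer_dvd_growth_dvd (hK : ∀ P : W.toAffine.Point, p • P = 0 → P = 0) (hγ : κ.IsTopGenerator γ) (D : W.SelmerDualData κ γ) (n : ℕ) :
    Nat.card ↥((W.selmerLayer κ (n + 1)).map
        (W.conjH1 p (κ.layerSubgroup (n + 1)) (γ ^ p ^ n) - AddMonoidHom.id (W.subgroupH1 p (κ.layerSubgroup (n + 1))))) ∣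
      Nat.card (↥(Ideal.span {((1 + PowerSeries.X : PowerSeries ℤ_[p]) ^ (p ^ n) - 1 : IwasawaAlgebra p)} • ⊤ : Submodule (IwasawaAlgebra p) D.X) ⧸
        (Ideal.span {(((Polynomial.cyclotomic (p ^ (n + 1)) ℤ_[p]).comp (Polynomial.X + 1) : ℤ_[p][X]) : IwasawaAlgebra p)} • ⊤ :
          Submodule (IwasawaAlgebra p) ↥(Ideal.span {((1 + PowerSeries.X : PowerSeries ℤ_[p]) ^ (p ^ n) - 1 : IwasawaAlgebra p)} • ⊤ :
            Submodule (IwasawaAlgebra p) D.X))) ∧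
    Nat.card (↥(Ideal.span {((1 + PowerSeries.X : PowerSeries ℤ_[p]) ^ (p ^ n) - 1 : IwasawaAlgebra p)} • ⊤ : Submodule (IwasawaAlgebra p) D.X) ⧸
        (Ideal.span {(((Polynomial.cyclotomic (p ^ (n + 1)) ℤ_[p]).comp (Polynomial.X + 1) : ℤ_[p][X]) : IwasawaAlgebra p)} • ⊤ :
          Submodule (IwasawaAlgebra p) ↥(Ideal.span {((1 + PowerSeries.X : PowerSeries ℤ_[p]) ^ (p ^ n) - 1 : IwasawaAlgebra p)} • ⊤ :
            Submodule (IwasawaAlgebra p) D.X))) ∣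
      Nat.card ↥((W.selmerLayer κ (n + 1)).map
          (W.conjH1 p (κ.layerSubgroup (n + 1)) (γ ^ p ^ n) - AddMonoidHom.id (W.subgroupH1 p (κ.layerSubgroup (n + 1))))) *
        Nat.card (W.KerG κ (n + 1)) := by
  obtain ⟨h1, h2⟩ := natCard_growth_mul_dvd_and_dvd W κ hγ D n
  rw [natCard_ker_layerToInfty_inf_eq_one W κ hK (n + 1), mul_one, natCard_cokerS_eq_natCard_kerG W κ hK (n + 1)] at h1
  rw [natCard_ker_layerToInfty_inf_eq_one W κ hK (n + 1), mul_one] at h2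
  exact ⟨h2, h1⟩

/-- ★★ **`E(K)[p] = 0`, `X` f.g. torsion: `p^{pⁿ(p−1)·μ(X)} ∣ #I_{n+1} · #ker g_{n+1}` at EVERY layer** — with `μ ≥ 1` the finite-level image times the control kernel is divisible by
`p^{pⁿ(p−1)}` at every step of the tower. [cite: GreenbergLNM1716, Thm. 1.10, Conj. 1.11] [cite: Washington1997, §13.3 Thm. 13.13] -/
theorem pow_dvd_natCard_map_selmerLayer_mul_kerG (hK : ∀ P : W.toAffine.Point, p • P = 0 → P = 0) (hγ : κ.IsTopGenerator γ) (D : W.SelmerDualData κ γ)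
    [Module.Finite (IwasawaAlgebra p) D.X] (hD : D.IsTorsion) (n : ℕ) :
    p ^ (p ^ n * (p - 1) * D.mu) ∣
      Nat.card ↥((W.selmerLayer κ (n + 1)).map
          (W.conjH1 p (κ.layerSubgroup (n + 1)) (γ ^ p ^ n) - AddMonoidHom.id (W.subgroupH1 p (κ.layerSubgroup (n + 1))))) *
        Nat.card (W.KerG κ (n + 1)) :=
  (pow_dvd_natCard_growth (M := D.X) hD n).trans (natCard_map_selmerLayer_dvd_growth_dvd W κ hK hγ D n).2

end NoTorsion

/-! ## §2 `p = 2` on the seed cell (no rational `2`-torsion abscissa): the norm kernel -/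

section Two

variable (W : WeierstrassCurve ℚ) [W.IsElliptic] (κ : ZpExtension ℚ 2) {γ : Field.absoluteGaloisGroup ℚ}

omit [W.IsElliptic] in
/-- The crux binder `∀ x, ¬ HasRationalTwoTorsionX W x` gives `E(ℚ)[2] = 0` in the shape `2 • P = 0 → P = 0` (gen 44's
`forall_two_smul_eq_zero_of_forall_not_hasRationalTwoTorsionX`; ANY `DecidableEq ℚ` instance — the Literature lemmas carry the classical one). [cite: SilvermanAEC2009, III.§2 and X.4.2] -/
theorem forall_two_nsmul_eq_zero {instDec : DecidableEq ℚ} (ht : ∀ x : ℚ, ¬ HasRationalTwoTorsionX W x) : ∀ P : W.toAffine.Point, 2 • P = 0 → P = 0 :=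
  fun P hP ↦ W.forall_two_smul_eq_zero_of_forall_not_hasRationalTwoTorsionX (instDec := instDec) ht P
    (by rw [show (2 : ℤ) = ((2 : ℕ) : ℤ) from rfl, natCast_zsmul]; exact hP)

/-- ★★★ `p = 2`, **ON THE SEED CELL** (`W/ℚ` elliptic, no rational `2`-torsion abscissa; any `ℤ₂`-extension `κ` with topological generator `γ`, any dual datum, any `n`; `g = γ^{2ⁿ}`,
`I_{n+1} = (g − 1)·Sel_{2^∞}(W/ℚ_{n+1})`, `M_{n+1} = ker(N_{ℚ_{n+1}/ℚ_n} | Sel_{2^∞}(W/ℚ_{n+1}))`): **`#I_{n+1} ∣ g_n ∣ #I_{n+1}·#ker g_{n+1}`**, **`g_n ∣ #M_{n+1}·#ker g_{n+1}`** and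
**`#M_{n+1} ∣ g_n·#M_{n+1}[2]`** — the growth number of `X(W/ℚ_∞)` read on ONE honest finite-level Selmer group. [cite: GreenbergLNM1716, §3 pp. 85–90, §4 Lemma 4.3] [cite: Mazur1972, §6] -/
theorem growth_dvd_normKer_mul_kerG_and_normKer_dvd (ht : ∀ x : ℚ, ¬ HasRationalTwoTorsionX W x) (hγ : κ.IsTopGenerator γ) (D : W.SelmerDualData κ γ) (n : ℕ) :
    (Nat.card ↥((W.selmerLayer κ (n + 1)).map
        (W.conjH1 2 (κ.layerSubgroup (n + 1)) (γ ^ 2 ^ n) - AddMonoidHom.id (W.subgroupH1 2 (κ.layerSubgroup (n + 1))))) ∣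
      Nat.card (↥(Ideal.span {((1 + PowerSeries.X : PowerSeries ℤ_[2]) ^ (2 ^ n) - 1 : IwasawaAlgebra 2)} • ⊤ : Submodule (IwasawaAlgebra 2) D.X) ⧸
        (Ideal.span {(((Polynomial.cyclotomic (2 ^ (n + 1)) ℤ_[2]).comp (Polynomial.X + 1) : ℤ_[2][X]) : IwasawaAlgebra 2)} • ⊤ :
          Submodule (IwasawaAlgebra 2) ↥(Ideal.span {((1 + PowerSeries.X : PowerSeries ℤ_[2]) ^ (2 ^ n) - 1 : IwasawaAlgebra 2)} • ⊤ :
            Submodule (IwasawaAlgebra 2) D.X)))) ∧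
    (Nat.card (↥(Ideal.span {((1 + PowerSeries.X : PowerSeries ℤ_[2]) ^ (2 ^ n) - 1 : IwasawaAlgebra 2)} • ⊤ : Submodule (IwasawaAlgebra 2) D.X) ⧸
        (Ideal.span {(((Polynomial.cyclotomic (2 ^ (n + 1)) ℤ_[2]).comp (Polynomial.X + 1) : ℤ_[2][X]) : IwasawaAlgebra 2)} • ⊤ :
          Submodule (IwasawaAlgebra 2) ↥(Ideal.span {((1 + PowerSeries.X : PowerSeries ℤ_[2]) ^ (2 ^ n) - 1 : IwasawaAlgebra 2)} • ⊤ :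
            Submodule (IwasawaAlgebra 2) D.X))) ∣
      Nat.card ↥(W.selmerLayer κ (n + 1) ⊓
          (W.conjH1 2 (κ.layerSubgroup (n + 1)) (γ ^ 2 ^ n) + AddMonoidHom.id (W.subgroupH1 2 (κ.layerSubgroup (n + 1)))).ker) *
        Nat.card (W.KerG κ (n + 1))) ∧
    (Nat.card ↥(W.selmerLayer κ (n + 1) ⊓
          (W.conjH1 2 (κ.layerSubgroup (n + 1)) (γ ^ 2 ^ n) + AddMonoidHom.id (W.subgroupH1 2 (κ.layerSubgroup (n + 1)))).ker) ∣
      Nat.card (↥(Ideal.span {((1 + PowerSeries.X : PowerSeries ℤ_[2]) ^ (2 ^ n) - 1 : IwasawaAlgebra 2)} • ⊤ : Submodule (IwasawaAlgebra 2) D.X) ⧸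
        (Ideal.span {(((Polynomial.cyclotomic (2 ^ (n + 1)) ℤ_[2]).comp (Polynomial.X + 1) : ℤ_[2][X]) : IwasawaAlgebra 2)} • ⊤ :
          Submodule (IwasawaAlgebra 2) ↥(Ideal.span {((1 + PowerSeries.X : PowerSeries ℤ_[2]) ^ (2 ^ n) - 1 : IwasawaAlgebra 2)} • ⊤ :
            Submodule (IwasawaAlgebra 2) D.X))) *
        Nat.card ↥(W.selmerLayer κ (n + 1) ⊓
            (W.conjH1 2 (κ.layerSubgroup (n + 1)) (γ ^ 2 ^ n) + AddMonoidHom.id (W.subgroupH1 2 (κ.layerSubgroup (n + 1)))).ker ⊓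
          AddSubgroup.torsionBy (W.subgroupH1 2 (κ.layerSubgroup (n + 1))) 2)) := by
  obtain ⟨h1, h2⟩ := natCard_map_selmerLayer_dvd_growth_dvd W κ (forall_two_nsmul_eq_zero W ht) hγ D n
  exact ⟨h1, h2.trans (mul_dvd_mul_right (natCard_map_dvd_natCard_normKer W κ hγ n) _),
    (natCard_normKer_dvd_mul W κ n).trans (mul_dvd_mul_right h1 _)⟩

/-- ★★ `p = 2`, on the seed cell, `X` f.g. torsion: **`2^{2ⁿ·μ(X)} ∣ #ker(N_{ℚ_{n+1}/ℚ_n} | Sel_{2^∞}(W/ℚ_{n+1})) · #ker g_{n+1}` at EVERY layer** — if `μ ≥ 1` the finite-level norm kernel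
times Greenberg's control kernel is divisible by `2^{2ⁿ}` at every step. [cite: GreenbergLNM1716, Thm. 1.10, Conj. 1.11] -/
theorem pow_dvd_natCard_normKer_mul_kerG (ht : ∀ x : ℚ, ¬ HasRationalTwoTorsionX W x) (hγ : κ.IsTopGenerator γ) (D : W.SelmerDualData κ γ)
    [Module.Finite (IwasawaAlgebra 2) D.X] (hD : D.IsTorsion) (n : ℕ) :
    2 ^ (2 ^ n * D.mu) ∣
      Nat.card ↥(W.selmerLayer κ (n + 1) ⊓
          (W.conjH1 2 (κ.layerSubgroup (n + 1)) (γ ^ 2 ^ n) + AddMonoidHom.id (W.subgroupH1 2 (κ.layerSubgroup (n + 1)))).ker) *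
        Nat.card (W.KerG κ (n + 1)) := by
  have h := pow_dvd_natCard_map_selmerLayer_mul_kerG W κ (forall_two_nsmul_eq_zero W ht) hγ D hD n
  rw [show (2 : ℕ) - 1 = 1 from rfl, mul_one] at h
  exact h.trans (mul_dvd_mul_right (natCard_map_dvd_natCard_normKer W κ hγ n) _)

end Two

end Summit.BirchSwinnertonDyer.BirchSwinnertonDyer.Theorems.AlignedTransportAtTwoHalfDescentLayerIndexGrowthFiniteCell

end
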